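import Literature.NumberTheory.LFunctions.ZetaOneLineBounds
import HarnessLib

/-!
# The trivial bound `ζ(σ + it) = O(t^{1-σ} log t)` uniformly in the strip `½ ≤ σ ≤ 1`

Topic `Literature/NumberTheory/LFunctions`. Everything here is PROVED, with explicit constants:

* `norm_riemannZeta_le_rpow_mul_log` — for `|t| ≥ 3` and `½ ≤ σ ≤ 1`,
  `‖ζ(σ + it)‖ ≤ 8 · |t|^{1-σ} · log|t|`;
* `zetaStripBound_one` — the packaging `∀ σ t, ½ ≤ σ → σ ≤ 1 → 3 ≤ t →
  ‖ζ(σ + it)‖ ≤ 8 · t^{1·(1-σ)} · log t` (the cell rh-jensen shape `ZetaStripBound 1 8 3` of the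
  log-band programme, memo TRANSFER-LENS-5 §5: exponent profile `λ = 1`, the input that suffices
  for realification rates `c < 4`; the convexity profile `λ = ½`, Titchmarsh (5.1.4), is NOT here).

Proof: the approximate formula `ζ(s) = Σ_{n ≤ N} n^{-s} + N^{1-s}/(s-1) − s∫_N^∞ {x}x^{-s-1}dx`
[Titchmarsh1986, §3.5 eq. (3.5.3)] (tree `ZetaOneLine.riemannZeta_eq_sum_add_sub_integral`) with
`N = ⌊|t|⌋`, exactly as in the tree's proof of Titchmarsh's Theorem 3.5
(`ZetaOneLine.norm_riemannZeta_le_log`), but with `n^{1-σ} ≤ |t|^{1-σ}` in place of `n^{1-σ} ≤ e^{½}`: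
the partial sum is `≤ |t|^{1-σ}(1 + log|t|)`, the middle term `≤ |t|^{1-σ}/3`, the tail
`≤ (14/3)|t|^{1-σ}`. RH-FREE; nothing here bears on the truth of RH. AI-produced formalisation
(prover-rh-jensen-eng-2-g4-0, 2026-08-26; idea-1 g5 WANTED W3, λ = 1 half); AI review is weaker than
expert review.

## References
* [Titchmarsh1986] E. C. Titchmarsh, *The Theory of the Riemann Zeta-Function*, 2nd ed., §3.5
  eq. (3.5.3) and Thm. 3.5; §5.1 eq. (5.1.1)–(5.1.4) for the convexity refinement.
-/

noncomputable section

open Complex Filter Topology Set MeasureTheory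

namespace Literature.NumberTheory.LFunctions.ZetaOneLine

/-- For `0 < y ≤ T` and `σ ≤ 1`: `y^{1-σ} ≤ T^{1-σ}`. [folklore] -/
private theorem rpow_one_sub_le_rpow_one_sub {y T σ : ℝ} (hy : 0 < y) (hyT : y ≤ T) (hσ : σ ≤ 1) :
    y ^ (1 - σ) ≤ T ^ (1 - σ) :=
  Real.rpow_le_rpow hy.le hyT (sub_nonneg.2 hσ)

/-- **The trivial strip bound** (from the approximate formula (3.5.3) with `N = ⌊|t|⌋`): for
`|t| ≥ 3` and `½ ≤ σ ≤ 1`, `‖ζ(σ + it)‖ ≤ 8 · |t|^{1-σ} · log|t|`.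
[cite: Titchmarsh1986, §3.5 eq. (3.5.3)] -/
theorem norm_riemannZeta_le_rpow_mul_log {s : ℂ} (ht : 3 ≤ |s.im|) (hσ : 1 / 2 ≤ s.re)
    (hσ1 : s.re ≤ 1) :
    ‖riemannZeta s‖ ≤ 8 * |s.im| ^ (1 - s.re) * Real.log |s.im| := by
  set t := s.im with htdef
  set σ := s.re with hσdef
  have hL : 1 < Real.log |t| :=
    MertensBound.one_lt_log_three.trans_le (Real.log_le_log (by norm_num) ht)
  have hL0 : 0 < Real.log |t| := zero_lt_one.trans hL
  have hσ0 : 0 < σ := by linarith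
  have ht0 : 0 < |t| := by linarith
  have hs1 : s ≠ 1 := by
    intro h
    have : t = 0 := by rw [htdef, h]; simp
    rw [this, abs_zero] at ht
    linarith
  -- `T = |t|^{1-σ} ≥ 1`
  set T : ℝ := |t| ^ (1 - σ) with hTdef
  have hT1 : 1 ≤ T := Real.one_le_rpow (by linarith) (sub_nonneg.2 hσ1)
  have hT0 : 0 < T := by linarith
  -- `N = ⌊|t|⌋`
  set N : ℕ := ⌊|t|⌋₊ with hNdef
  have hN3 : 3 ≤ N := Nat.le_floor (by simpa using ht)
  have hN1 : 1 ≤ N := le_trans (by norm_num) hN3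
  have hNt : (N : ℝ) ≤ |t| := Nat.floor_le (abs_nonneg t)
  have hNt' : |t| / 2 ≤ N := by
    have := Nat.lt_floor_add_one |t|
    rw [← hNdef] at this
    linarith
  have hN0 : (0 : ℝ) < N := by exact_mod_cast (lt_of_lt_of_le (by norm_num) hN3)
  have hformula := riemannZeta_eq_sum_add_sub_integral (by simpa using hσ0) hs1 hN1
  -- (a) the partial sum: `≤ T (1 + log N) ≤ 2 T log|t|`
  have ha : ‖∑ n ∈ Finset.Icc 1 N, (n : ℂ) ^ (-s)‖ ≤ 2 * T * Real.log |t| := by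
    have h1 : ‖∑ n ∈ Finset.Icc 1 N, (n : ℂ) ^ (-s)‖ ≤ ∑ n ∈ Finset.Icc 1 N, T * (n : ℝ)⁻¹ := by
      refine (norm_sum_le _ _).trans (Finset.sum_le_sum fun n hn ↦ ?_)
      rw [Finset.mem_Icc] at hn
      have hn0 : 0 < n := hn.1
      have hnR : (0 : ℝ) < n := by exact_mod_cast hn.1
      have hnt : (n : ℝ) ≤ |t| := le_trans (by exact_mod_cast hn.2) hNt
      rw [norm_natCast_cpow_of_pos hn0, neg_re, ← hσdef]
      have : (n : ℝ) ^ (-σ) = (n : ℝ) ^ (1 - σ) * (n : ℝ)⁻¹ := by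
        rw [← Real.rpow_neg_one, ← Real.rpow_add (by positivity)]
        ring_nf
      rw [this]
      gcongr
      exact rpow_one_sub_le_rpow_one_sub hnR hnt hσ1
    have h2 : ∑ n ∈ Finset.Icc 1 N, (n : ℝ)⁻¹ ≤ 1 + Real.log N := by
      have := harmonic_le_one_add_log N
      simpa [harmonic_eq_sum_Icc] using this
    have h3 : Real.log N ≤ Real.log |t| := Real.log_le_log hN0 hNt
    calc ‖∑ n ∈ Finset.Icc 1 N, (n : ℂ) ^ (-s)‖ ≤ ∑ n ∈ Finset.Icc 1 N, T * (n : ℝ)⁻¹ := h1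
      _ = T * ∑ n ∈ Finset.Icc 1 N, (n : ℝ)⁻¹ := by rw [Finset.mul_sum]
      _ ≤ T * (1 + Real.log N) := by gcongr
      _ ≤ T * (2 * Real.log |t|) := by gcongr; linarith
      _ = 2 * T * Real.log |t| := by ring
  -- (b) the term `N^{1-s}/(s-1)`: `≤ T/3`
  have hb : ‖(N : ℂ) ^ (1 - s) / (s - 1)‖ ≤ T := by
    rw [norm_div, norm_natCast_cpow_of_pos (by omega), sub_re, one_re, ← hσdef]
    have hs1norm : |t| ≤ ‖s - 1‖ := by
      have := abs_im_le_norm (s - 1)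
      simpa [← htdef] using this
    have h3 : (N : ℝ) ^ (1 - σ) ≤ T := rpow_one_sub_le_rpow_one_sub hN0 hNt hσ1
    rw [div_le_iff₀ (lt_of_lt_of_le (by linarith) hs1norm)]
    nlinarith
  -- (c) the tail integral: `≤ (14/3) T`
  have hc : ‖s * ∫ x in Ioi (N : ℝ), ((Int.fract x : ℝ) : ℂ) * (x : ℂ) ^ (-(s + 1))‖ ≤ 5 * T := by
    rw [norm_mul]
    have h1 := norm_integral_Ioi_fract_mul_cpow_le (s := s) (by simpa using hσ0)
      (show (1 : ℝ) ≤ N by exact_mod_cast hN1)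
    rw [← hσdef] at h1
    have hsn : ‖s‖ ≤ σ + |t| := by
      have := Complex.norm_le_abs_re_add_abs_im s
      rwa [← hσdef, ← htdef, abs_of_pos hσ0] at this
    have hNσ : (N : ℝ) ^ (-σ) ≤ 2 * T / |t| := by
      have : (N : ℝ) ^ (-σ) = (N : ℝ) ^ (1 - σ) * (N : ℝ)⁻¹ := by
        rw [← Real.rpow_neg_one, ← Real.rpow_add hN0]
        ring_nf
      rw [this]
      have h3 : (N : ℝ) ^ (1 - σ) ≤ T := rpow_one_sub_le_rpow_one_sub hN0 hNt hσ1
      have h4 : (N : ℝ)⁻¹ ≤ 2 / |t| := by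
        rw [inv_eq_one_div, div_le_div_iff₀ hN0 (by linarith)]
        linarith
      calc (N : ℝ) ^ (1 - σ) * (N : ℝ)⁻¹ ≤ T * (2 / |t|) := by
            gcongr
        _ = 2 * T / |t| := by ring
    calc ‖s‖ * ‖∫ x in Ioi (N : ℝ), ((Int.fract x : ℝ) : ℂ) * (x : ℂ) ^ (-(s + 1))‖
        ≤ (σ + |t|) * ((N : ℝ) ^ (-σ) / σ) := by gcongr
      _ ≤ (σ + |t|) * ((2 * T / |t|) / σ) := by gcongr
      _ = 2 * T / |t| + 2 * T / σ := by field_simp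
      _ ≤ 2 * T / 3 + 2 * T / (1 / 2) := by gcongr
      _ ≤ 5 * T := by linarith
  rw [hformula]
  calc ‖∑ n ∈ Finset.Icc 1 N, (n : ℂ) ^ (-s) + (N : ℂ) ^ (1 - s) / (s - 1) -
        s * ∫ x in Ioi (N : ℝ), ((Int.fract x : ℝ) : ℂ) * (x : ℂ) ^ (-(s + 1))‖
      ≤ ‖∑ n ∈ Finset.Icc 1 N, (n : ℂ) ^ (-s)‖ + ‖(N : ℂ) ^ (1 - s) / (s - 1)‖ +
        ‖s * ∫ x in Ioi (N : ℝ), ((Int.fract x : ℝ) : ℂ) * (x : ℂ) ^ (-(s + 1))‖ :=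
        (norm_sub_le _ _).trans (by gcongr; exact norm_add_le _ _)
    _ ≤ 2 * T * Real.log |t| + T + 5 * T := by gcongr
    _ ≤ 8 * T * Real.log |t| := by nlinarith

/-- **Vertical-line packaging** (the cell rh-jensen shape `ZetaStripBound 1 8 3`): for real
`½ ≤ σ ≤ 1` and `t ≥ 3`, `‖ζ(σ + it)‖ ≤ 8 · t^{1·(1-σ)} · log t`.
[cite: Titchmarsh1986, §3.5 eq. (3.5.3)] -/
theorem zetaStripBound_one :
    ∀ σ t : ℝ, 1 / 2 ≤ σ → σ ≤ 1 → 3 ≤ t →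
      ‖riemannZeta ((σ : ℂ) + t * Complex.I)‖ ≤ 8 * t ^ (1 * (1 - σ)) * Real.log t := by
  intro σ t hσ hσ1 ht
  have ht0 : 0 ≤ t := by linarith
  have h := norm_riemannZeta_le_rpow_mul_log (s := (σ : ℂ) + t * Complex.I)
    (by simpa [abs_of_nonneg ht0] using ht) (by simpa using hσ) (by simpa using hσ1)
  simpa [abs_of_nonneg ht0, one_mul] using h

end Literature.NumberTheory.LFunctions.ZetaOneLine
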